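import Mathlib
import Literature.AlgebraicGeometry.Resolution.PointBlowupFlagInvariant
import Literature.AlgebraicGeometry.Resolution.PointBlowupHeightVectorDrops
import Summits.ResolutionOfSingularities.ResolutionOfSingularities.Theorems.WeightedInvariantLocalWeightedDropInsepPointStep
import Summits.ResolutionOfSingularities.ResolutionOfSingularities.Theorems.WeightedInvariantLocalWeightedDropInsepNewtonMeasures

/-!
# `WeightedInvariant.LocalWeightedDrop`, line `hasse-ridge-face-selection`: the SUPPORT of the vertical successor
# (`(α, β) ↦ (α + β − 2, β)`, Hauser–Wagner's move (V) `F(y, yz)/y²`) in the lift's chart coordinates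

Crux item stmt-ResolutionOfSingularities-8899 `LocalWeightedDrop` (route `ResolutionOfSingularities/WeightedInvariant`),
serving the door `WeightedConstruction` stmt-ResolutionOfSingularities-0571.  [OURS · L1 W4.3, chain w43, stub worker 3
(gen 2): unit M1 (second tranche) / M2 prerequisites of the S2iM attack plan (L/res-L1-w43-stub-3/S2iM-ATTACK-PLAN.md); NOT a
statement of any manuscript.]

Orientation: free letter `y = x₀` (slot `0`), rigid letter `z = x₁` (slot `1`).  The point-blow-up chart of the lift
`won_insep_of_pointStep` at the flag point `c = (c₀, 0)`, live slot `0`, is `π : x₀ ↦ c₀ X₀, x₁ ↦ X₀·X₁` (`X₀` the new `y`,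
`X₁` the new `z`), and the successor `A′` is defined by `π^* A = X₀² · A′`.
* `InsepNewton.coeff_subst_piV`: `[X₀^a X₁^b] π^* A = c₀^{a−b} · [x₀^{a−b} x₁^b] A` (`b ≤ a`; else `0`) — `π` is a monomial
  substitution, `(α, β) ↦ (α + β, β)`;
* `InsepNewton.coeff_vSucc`: `[X₀^a X₁^b] A′ = c₀^{a+2−b} · [x₀^{a+2−b} x₁^b] A` (`b ≤ a + 2`; else `0`);
* support transport both ways (`coeff_vSucc_ne_zero_iff`, `coeff_vSucc_ne_zero_of`) and the first consequence for the
  Newton measures: `ordVarPS A′ 1 = ordVarPS A 1` (the rigid order `β₁` is kept; `A ≠ 0` of order `≥ 2`).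
The height inequality `height(A′) ≤ height(A) − 1` (HW p. 205, move (V)) is the next tranche.
-/

set_option linter.dupNamespace false -- mandated namespace of this single-conjunct summit

namespace Summit.ResolutionOfSingularities.ResolutionOfSingularities.Theorems

namespace InsepNewton

open MvPowerSeries
open Literature.AlgebraicGeometry.Resolution
open Literature.AlgebraicGeometry.Resolution.HauserPerlega2024 (ordAlong)
open Literature.AlgebraicGeometry.Resolution.HauserWagner2014 (ordVarPS degAlongPS heightPS)

variable {K : Type} [Field K]

/-- The vertical chart `π_V : x₀ ↦ c₀ X₀, x₁ ↦ X₀ X₁` in the lift's spelling (`c = (c₀, 0)`, live slot `0`). -/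
theorem piV_eq (c₀ : K) :
    (fun l : Fin 2 => if l = 0 then C ((![c₀, 0] : Fin 2 → K) 0) * X 0 else
      X 0 * (C ((![c₀, 0] : Fin 2 → K) l) + (X 1 : MvPowerSeries (Fin 2) K))) =
      fun l : Fin 2 => if l = 0 then C c₀ * X 0 else X 0 * X 1 := by
  funext l
  rcases (by fin_cases l <;> simp : l = 0 ∨ l = 1) with rfl | rfl
  · simp
  · simp

/-- `π_V` is substitutable. -/
theorem hasSubst_piV (c₀ : K) : HasSubst (fun l : Fin 2 => if l = 0 then C c₀ * X 0 else (X 0 * X 1 : MvPowerSeries (Fin 2) K)) :=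
  hasSubst_of_constantCoeff_zero fun l => by
    rcases (by fin_cases l <;> simp : l = 0 ∨ l = 1) with rfl | rfl <;> simp [constantCoeff_X]

/-- The monomial `x^d` under `π_V`: `c₀^{d₀} · X₀^{d₀+d₁} X₁^{d₁}`. -/
theorem prod_piV_pow (c₀ : K) (d : Fin 2 →₀ ℕ) :
    (d.prod fun s n => (fun l : Fin 2 => if l = 0 then C c₀ * X 0 else (X 0 * X 1 : MvPowerSeries (Fin 2) K)) s ^ n) =
      monomial (Finsupp.single 0 (d 0 + d 1) + Finsupp.single 1 (d 1)) (c₀ ^ d 0) := by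
  have hC : (C (c₀ ^ d 0) : MvPowerSeries (Fin 2) K) = monomial 0 (c₀ ^ d 0) := by
    ext e; rw [coeff_C, coeff_monomial]
  rw [Finsupp.prod_pow, Fin.prod_univ_two]
  simp only [Fin.isValue, ↓reduceIte, one_ne_zero]
  rw [mul_pow, mul_pow, ← map_pow, X_pow_eq, X_pow_eq, X_pow_eq, hC]
  simp only [monomial_mul_monomial, mul_one, zero_add]
  have hexp : (Finsupp.single (0 : Fin 2) (d 0) + (Finsupp.single 0 (d 1) + Finsupp.single 1 (d 1)) : Fin 2 →₀ ℕ) =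
      Finsupp.single 0 (d 0 + d 1) + Finsupp.single 1 (d 1) := by
    rw [← add_assoc, ← Finsupp.single_add]
  rw [hexp]

/-- COEFFICIENTS OF `π_V^* A`: `[X₀^a X₁^b] = c₀^{a−b} · [x₀^{a−b} x₁^b] A` for `b ≤ a`, else `0`. -/
theorem coeff_subst_piV (c₀ : K) (A : MvPowerSeries (Fin 2) K) (e : Fin 2 →₀ ℕ) :
    coeff e (subst (fun l : Fin 2 => if l = 0 then C c₀ * X 0 else (X 0 * X 1 : MvPowerSeries (Fin 2) K)) A) =
      if e 1 ≤ e 0 then c₀ ^ (e 0 - e 1) * coeff (Finsupp.single 0 (e 0 - e 1) + Finsupp.single 1 (e 1)) A else 0 := by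
  classical
  rw [coeff_subst (hasSubst_piV c₀)]
  simp_rw [prod_piV_pow, coeff_monomial]
  have hkey : ∀ d : Fin 2 →₀ ℕ, (e = Finsupp.single 0 (d 0 + d 1) + Finsupp.single 1 (d 1)) ↔
      (e 1 ≤ e 0 ∧ d = Finsupp.single 0 (e 0 - e 1) + Finsupp.single 1 (e 1)) := by
    intro d
    constructor
    · intro h
      have h0 : e 0 = d 0 + d 1 := by rw [h]; simp
      have h1 : e 1 = d 1 := by rw [h]; simp
      refine ⟨by omega, ?_⟩
      ext l
      rcases (by fin_cases l <;> simp : l = 0 ∨ l = 1) with rfl | rfl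
      · simp; omega
      · simp; omega
    · rintro ⟨hle, rfl⟩
      ext l
      rcases (by fin_cases l <;> simp : l = 0 ∨ l = 1) with rfl | rfl
      · simp; omega
      · simp
  by_cases hle : e 1 ≤ e 0
  · rw [if_pos hle, finsum_eq_single _ (Finsupp.single 0 (e 0 - e 1) + Finsupp.single 1 (e 1))]
    · rw [if_pos ((hkey _).mpr ⟨hle, rfl⟩), smul_eq_mul, mul_comm]
      congr 2
      simp
    · intro d hd
      rw [if_neg (fun h => hd ((hkey d).mp h).2), smul_zero]
  · rw [if_neg hle]
    exact finsum_eq_zero_of_forall_eq_zero fun d => by rw [if_neg (fun h => hle ((hkey d).mp h).1), smul_zero]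

/-- COEFFICIENTS OF THE VERTICAL SUCCESSOR `A′` (`π_V^* A = X₀² A′`): `[X₀^a X₁^b] A′ = c₀^{a+2−b} · [x₀^{a+2−b} x₁^b] A`
for `b ≤ a + 2`, else `0`. -/
theorem coeff_vSucc (c₀ : K) {A A' : MvPowerSeries (Fin 2) K}
    (hfac : subst (fun l : Fin 2 => if l = 0 then C c₀ * X 0 else (X 0 * X 1 : MvPowerSeries (Fin 2) K)) A = X 0 ^ 2 * A')
    (e : Fin 2 →₀ ℕ) :
    coeff e A' = if e 1 ≤ e 0 + 2 then c₀ ^ (e 0 + 2 - e 1) *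
      coeff (Finsupp.single 0 (e 0 + 2 - e 1) + Finsupp.single 1 (e 1)) A else 0 := by
  classical
  have h : coeff (e + Finsupp.single 0 2) (X 0 ^ 2 * A') = coeff e A' := by
    rw [X_pow_eq, coeff_monomial_mul, if_pos (by simp), one_mul, add_tsub_cancel_right]
  rw [← h, ← hfac, coeff_subst_piV]
  simp only [Finsupp.add_apply, Finsupp.single_eq_same, Finsupp.single_eq_of_ne (one_ne_zero : (1 : Fin 2) ≠ 0), add_zero]

/-- SUPPORT OF THE VERTICAL SUCCESSOR: `(a, b) ∈ supp A′ ↔ b ≤ a + 2 ∧ (a + 2 − b, b) ∈ supp A` (`c₀ ≠ 0`). -/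
theorem coeff_vSucc_ne_zero_iff {c₀ : K} (hc₀ : c₀ ≠ 0) {A A' : MvPowerSeries (Fin 2) K}
    (hfac : subst (fun l : Fin 2 => if l = 0 then C c₀ * X 0 else (X 0 * X 1 : MvPowerSeries (Fin 2) K)) A = X 0 ^ 2 * A')
    (a b : ℕ) :
    coeff (Finsupp.single 0 a + Finsupp.single 1 b) A' ≠ 0 ↔
      b ≤ a + 2 ∧ coeff (Finsupp.single 0 (a + 2 - b) + Finsupp.single 1 b) A ≠ 0 := by
  rw [coeff_vSucc c₀ hfac]
  simp only [Finsupp.add_apply, Finsupp.single_eq_same, Finsupp.single_eq_of_ne (zero_ne_one : (0 : Fin 2) ≠ 1),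
    Finsupp.single_eq_of_ne (one_ne_zero : (1 : Fin 2) ≠ 0), zero_add, add_zero]
  by_cases hle : b ≤ a + 2
  · rw [if_pos hle]
    simp [hle, pow_ne_zero _ hc₀]
  · rw [if_neg hle]
    simp [hle]

/-- … and the inverse transport: `(α, β) ∈ supp A`, `α + β ≥ 2` ⇒ `(α + β − 2, β) ∈ supp A′`. -/
theorem coeff_vSucc_ne_zero_of {c₀ : K} (hc₀ : c₀ ≠ 0) {A A' : MvPowerSeries (Fin 2) K}
    (hfac : subst (fun l : Fin 2 => if l = 0 then C c₀ * X 0 else (X 0 * X 1 : MvPowerSeries (Fin 2) K)) A = X 0 ^ 2 * A')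
    {α β : ℕ} (h2 : 2 ≤ α + β) (h : coeff (Finsupp.single 0 α + Finsupp.single 1 β) A ≠ 0) :
    coeff (Finsupp.single 0 (α + β - 2) + Finsupp.single 1 β) A' ≠ 0 := by
  rw [coeff_vSucc_ne_zero_iff hc₀ hfac]
  refine ⟨by omega, ?_⟩
  have : α + β - 2 + 2 - β = α := by omega
  rw [this]
  exact h

/-- A support point, respelled as `(d₀, d₁)` (cf. `Literature.NumberTheory.EllipticCurves.finsupp_fin_two_eq`, not imported). -/
theorem coeff_single_add_single_ne_zero {A : MvPowerSeries (Fin 2) K} {d : Fin 2 →₀ ℕ} (h : coeff d A ≠ 0) :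
    coeff (Finsupp.single 0 (d 0) + Finsupp.single 1 (d 1)) A ≠ 0 := by
  have hd : Finsupp.single 0 (d 0) + Finsupp.single 1 (d 1) = d := by
    ext l
    rcases (by fin_cases l <;> simp : l = 0 ∨ l = 1) with rfl | rfl <;> simp
  rw [hd]
  exact h

/-- Every support point of a series of order `≥ 2` has total degree `≥ 2`. -/
theorem two_le_add_of_coeff_ne_zero {A : MvPowerSeries (Fin 2) K} (hA : (2 : ℕ∞) ≤ A.order) {α β : ℕ}
    (h : coeff (Finsupp.single 0 α + Finsupp.single 1 β) A ≠ 0) : 2 ≤ α + β := by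
  by_contra hlt
  apply h
  apply coeff_of_lt_order
  rw [map_add, Finsupp.degree_single, Finsupp.degree_single]
  exact lt_of_lt_of_le (by exact_mod_cast (not_le.mp hlt)) hA

/-- THE RIGID ORDER IS KEPT by the vertical move: `ord_z(A′) = ord_z(A)` (`A ≠ 0` of order `≥ 2`, `c₀ ≠ 0`). -/
theorem ordVarPS_vSucc_one {c₀ : K} (hc₀ : c₀ ≠ 0) {A A' : MvPowerSeries (Fin 2) K} (hA : A ≠ 0)
    (hA2 : (2 : ℕ∞) ≤ A.order)
    (hfac : subst (fun l : Fin 2 => if l = 0 then C c₀ * X 0 else (X 0 * X 1 : MvPowerSeries (Fin 2) K)) A = X 0 ^ 2 * A') :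
    ordVarPS A' 1 = ordVarPS A 1 := by
  refine le_antisymm ?_ ?_
  · obtain ⟨d, hd', hd1⟩ := exists_coeff_apply_eq_ordVarPS 1 hA
    have hd := coeff_single_add_single_ne_zero hd'
    have h := coeff_vSucc_ne_zero_of hc₀ hfac (two_le_add_of_coeff_ne_zero hA2 hd) hd
    have := ordVarPS_le 1 h
    simp only [Finsupp.add_apply, Finsupp.single_eq_same, Finsupp.single_eq_of_ne (one_ne_zero : (1 : Fin 2) ≠ 0),
      zero_add] at this
    rw [← hd1]; exact this
  · have hA' : A' ≠ 0 := by
      obtain ⟨d, hd', -⟩ := exists_coeff_apply_eq_ordVarPS 1 hA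
      have hd := coeff_single_add_single_ne_zero hd'
      have h := coeff_vSucc_ne_zero_of hc₀ hfac (two_le_add_of_coeff_ne_zero hA2 hd) hd
      rintro rfl
      exact h (map_zero _)
    obtain ⟨e, he', he1⟩ := exists_coeff_apply_eq_ordVarPS 1 hA'
    have he := coeff_single_add_single_ne_zero he'
    obtain ⟨-, h⟩ := (coeff_vSucc_ne_zero_iff hc₀ hfac (e 0) (e 1)).mp he
    have := ordVarPS_le 1 h
    simp only [Finsupp.add_apply, Finsupp.single_eq_same, Finsupp.single_eq_of_ne (one_ne_zero : (1 : Fin 2) ≠ 0),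
      zero_add] at this
    rw [← he1]; exact this

end InsepNewton

end Summit.ResolutionOfSingularities.ResolutionOfSingularities.Theorems
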